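import Summits.BirchSwinnertonDyer.BirchSwinnertonDyer.Theorems.EdixhovenFibreFiveSevenTwistDegreeStepFiveSevenKP
import Summits.BirchSwinnertonDyer.BirchSwinnertonDyer.Theorems.EdixhovenFibreFiveSevenTwistDegreeStepFiveSevenTorsTwist
import HarnessLib

/-!
# Route `EdixhovenFibreFiveSeven`, crux KP57 (stmt-BirchSwinnertonDyer-23810): `KPResidueManinUnitFiveSeven`
# BY NAME from modularity, F″ and the ONE remaining modular input L-TWIST (conditional result)

Cell `pub/bsd-wall` (D-0145 line `route-BirchSwinnertonDyer-EdixhovenFibreFiveSeven`), seat `bsd-line-edix-p5`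
(prover, width-5 attach). THEOREMS ONLY (no definition, no named fact, no `sorry`). Nothing is closed
unconditionally and BSD is not proved by this file.

The crux KP57 `KPResidueManinUnitFiveSeven` (stmt-BirchSwinnertonDyer-23810) is the Kosters–Pannekoek residue of
Manin's `p`-part at `p ∈ {5, 7}`: for a globally minimal `V/ℚ` additive at `p`, `E[p]` irreducible, no `Iₙ*`
fibre, `ord_p Δ_min ≤ 4`, whose isogeny class carries a `ℚ_p`-RATIONAL POINT OF ORDER `p`, all conductor-level
modular degrees divisible by `p` and `N(V) > 5·10⁵`: SOME conductor-level datum of `V` has `p ∤ c`. It is the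
binder `hK` of the route's deciding theorem `closes` and enters there only through the twin
`TwistDegreeStepFiveSevenOfKP` (TDS57 granted KP57).

This file reduces KP57 BY NAME to the same two named inputs to which the sibling seats reduced the other Manin
binders of the route (K★ 22226 ⟸ F″, p581141; TDS11 22228 ⟸ F″, p582260; TDS57 22227 ⟸ F″ ∧ L-TWIST, p589348),
plus modularity (the item itself carries no `exists_isNewformOf` binder, and its hypotheses construct no datum):

`kpResidueManinUnitFiveSeven_of_kato_of_periodTwist : exists_isNewformOf → F″ → L-TWIST → KPResidueManinUnitFiveSeven`,

where F″ = `kato_neron_isIntegral_twistedSymbolSum_of_additive_five_le` (cite-only, Kato 2004 (8.1.3)/Thm. 9.7/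
Thm. 6.6 (1) + Kim–Nakamura 2020 Cor. 2.4 off the Kosters–Pannekoek exception) and (L-TWIST) `hLT` is VERBATIM the
binder of `TwistDegreeStepFiveSevenKP.twistDegreeStepFiveSeven_of_kato_of_twistInputs` (p585596) and of
`TwistDegreeStepFiveSevenKPTors.twistDegreeStepFiveSeven_of_kato_of_periodTwist` (p589348): for `V₀/ℚ` globally
minimal with `E[p]` irreducible (`p ≥ 5`), a conductor-level datum `D₀`, an odd prime `q ≠ p` with `q ∤ N(V₀)`, a
globally minimal model `Vχ` of `V₀ ⊗ χ_{q*}`, `s² = q*`, and every newform `g` of `Vχ`: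
`Λ(D₀.f) ⊆ s·Λ(g) + p·Λ(D₀.f)` (the twisted-period decomposition; being assembled by the sibling seats from the
double-twist identity, three-copy Ihara and the non-Eisenstein ideal of `f` mod `p`).

Proof (the twist branch of the sibling proof of p589348, with the conclusion of the landed repair kept as it
is — a conductor-level datum of `V` with `p ∤ c` — instead of being fed into the twist-degree step): the optimal
member `V₀ ∼ V` (`X12.exists_isIsogenous_optimal`), Dirichlet's auxiliary prime `q ≡ 1 (4)` with `q*` a
non-residue mod `p` and `q > N(V₀)` (`TwistDegreeStepFiveSevenKP.exists_auxPrime`), a globally minimal model of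
the `q*`-twist (`exists_minimal_twist_pStar`), additivity of the unit twist
(`AddvUnitTwist.addv_of_model_twist_auxPrime`), TORS-TWIST (`TorsTwist.torsTwist57_input`: the `ℚ_p`-rational
`p`-torsion point of the class of `V` — a HYPOTHESIS of KP57 — is killed on the whole twisted class), and the
landed repair `TwistDegreeStepFiveSevenUnitTwist.exists_datum_not_dvd_c_of_kato_of_unitTwist` (F″ + lever on the
twisted class + Stevens (5.2) + L-TWIST + prime-to-`p` transport back to `V`). The KP57 hypotheses "no `Iₙ*`",
"`ord_p Δ_min ≤ 4`", "all degrees divisible by `p`" and "`N > 5·10⁵`" are not used: granted F″ and L-TWIST the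
conclusion holds on the whole additive `E[p]`-irreducible locus at `p ∈ {5, 7}` once the class has local
`p`-torsion (and off that locus by the tame-twist lever directly, sibling files).

CONDITIONAL RESULT (F″ cite-only; L-TWIST a hypothesis); the item stays open for its own signature. BSD is not
proved by this.

References: [Kato2004Asterisque] (8.1.3), Thm. 9.7, Thm. 6.6 (1); [KimNakamura2020] Cor. 2.4;
[KostersPannekoek2017] Thm. 1, Cor. 2; [Stevens1989] §5 Lemma (5.2); [Ribet1984ICM] Thm. 4.1;
[DarmonDiamondTaylor1995] Lemma 4.28, §4.5; [EdixhovenManin1991] §4; [Mazur1977] Ch. III §5.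
-/

set_option autoImplicit false
-- the Theorems directory repeats the summit name (sibling precedent `SignedBaseChangeAssembly.lean`)
set_option linter.dupNamespace false

noncomputable section

open scoped Classical MatrixGroups

open WeierstrassCurve NumberField Literature.NumberTheory.EllipticCurves
  Literature.NumberTheory.EllipticCurves.ModularForms
  Literature.NumberTheory.EllipticCurves.Rank1Residual
  Literature.NumberTheory.DiophantineGeometry IsDedekindDomain Rat.HeightOneSpectrum
  Summit.BirchSwinnertonDyer.Rank1Residual Summit.BirchSwinnertonDyer.Rank1Residual.Additive
  Summit.BirchSwinnertonDyer.BirchSwinnertonDyer.Theorems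
  Summit.BirchSwinnertonDyer.BirchSwinnertonDyer.Theses.EdixhovenFibreFiveSeven CongruenceSubgroup

namespace Summit.BirchSwinnertonDyer.BirchSwinnertonDyer.Theorems.KPResidueOfKatoPeriodTwist

/-- **A conductor-level datum with `p ∤ c` on the Kosters–Pannekoek residue, GRANTED modularity, F″ and
L-TWIST.** For `p ∈ {5, 7}` and `V/ℚ` globally minimal, additive at `p` with `E[p]` irreducible, whose isogeny
class contains a globally minimal member with a `ℚ_p`-rational point of order `p`: some conductor-level datum
`D` of `V` has `p ∤ c(D)`. Proof = the twist branch of the sibling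
`TwistDegreeStepFiveSevenKPTors.twistDegreeStepFiveSeven_of_kato_of_periodTwist` (p589348) stopped one step
early: optimal member, Dirichlet's auxiliary prime `q` with `q*` a non-residue mod `p`, minimal model of the
`q*`-twist, `AddvUnitTwist.addv_of_model_twist_auxPrime`, `TorsTwist.torsTwist57_input`, and
`TwistDegreeStepFiveSevenUnitTwist.exists_datum_not_dvd_c_of_kato_of_unitTwist`. CONDITIONAL (F″ cite-only;
L-TWIST `hLT` a hypothesis, verbatim the binder of p585596/p589348); BSD is not proved by this.
[cite: Kato2004Asterisque, (8.1.3) (p. 180), Thm. 9.7 (p. 189)] [cite: KostersPannekoek2017, Thm. 1 and Cor. 2]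
[cite: Stevens1989, Lemma (5.2) p. 96] [cite: Mazur1977, Ch. III §5, Step 1, p. 158] -/
theorem exists_datum_not_dvd_c_of_kato_of_periodTwist_of_torsion
    (hnf : exists_isNewformOf)
    (hF : kato_neron_isIntegral_twistedSymbolSum_of_additive_five_le)
    (hLT : ∀ (p : ℕ) [Fact p.Prime] (q : ℕ) [Fact q.Prime] (V₀ : WeierstrassCurve ℚ) [V₀.IsElliptic]
      [V₀.IsGloballyMinimal] [NeZero (V₀.conductorNorm ℤ)]
      (D₀ : ModularParametrizationData V₀ (V₀.conductorNorm ℤ)), 5 ≤ p → Irr V₀ p → q ≠ 2 → q ≠ p →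
      ¬ q ∣ V₀.conductorNorm ℤ →
      ∀ (Vχ : WeierstrassCurve ℚ) [Vχ.IsElliptic] [Vχ.IsGloballyMinimal] (v : VariableChange ℚ),
      v • V₀.quadraticTwist (((-1 : ℤ) ^ (q / 2) * q : ℤ) : ℚ) = Vχ →
      ∀ (s : ℂ), s ^ 2 = (((-1 : ℤ) ^ (q / 2) * q : ℤ) : ℂ) →
      ∀ (N' : ℕ) [NeZero N'] (g : CuspForm (Gamma0 N') 2), IsNewformOf Vχ g →
      ∀ z ∈ periodLattice D₀.f, ∃ w ∈ periodLattice g, ∃ y ∈ periodLattice D₀.f, z = s * w + (p : ℂ) * y)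
    {p : ℕ} [hp : Fact p.Prime] (V : WeierstrassCurve ℚ) [V.IsElliptic] [V.IsGloballyMinimal]
    [NeZero (V.conductorNorm ℤ)] (hp57 : p = 5 ∨ p = 7) (hadd : Addv V p) (hirr : Irr V p)
    (hW' : ∃ (W' : WeierstrassCurve ℚ) (_ : W'.IsElliptic) (_ : W'.IsGloballyMinimal)
      (P : (W'.baseChange ℚ_[p]).toAffine.Point), IsIsogenous V W' ∧ P ≠ 0 ∧ p • P = 0) :
    ∃ D : ModularParametrizationData V (V.conductorNorm ℤ), ¬ (p : ℤ) ∣ D.c := by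
  have hp5 : 5 ≤ p := by omega
  obtain ⟨W', hE', hM', P, hisoW', hP0, hP⟩ := hW'
  -- the optimal member of the class of `V`
  obtain ⟨V₀, hE₀, hM₀, hNz₀, D₀, hiso, -, hopt₀⟩ := X12.exists_isIsogenous_optimal hnf V
  haveI := hE₀
  haveI := hM₀
  haveI := hNz₀
  have hirr₀ : Irr V₀ p := (X12.irr_iff_of_isIsogenous hiso p).mp hirr
  have hadd₀ : Addv V₀ p := (X2.addv_iff_of_isIsogenous (p := p) hiso).mp hadd
  have hisoVW : IsIsogenous V₀ W' := (hiso.symm_of_charZero).trans' hisoW'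
  -- the auxiliary prime
  obtain ⟨q, hqN, hq, hq2, hqp, hnsq⟩ := TwistDegreeStepFiveSevenKP.exists_auxPrime hp57 (V₀.conductorNorm ℤ)
  haveI : Fact q.Prime := ⟨hq⟩
  have hqN' : ¬ q ∣ V₀.conductorNorm ℤ := fun h ↦
    absurd (Nat.le_of_dvd (Nat.pos_of_ne_zero (NeZero.ne _)) h) (by omega)
  have hqsq : ¬ q ^ 2 ∣ V₀.conductorNorm ℤ := fun h ↦ hqN' ((dvd_pow_self q two_ne_zero).trans h)
  have hgm : V₀.HasGoodReductionAtPrime q ∨ V₀.HasMultiplicativeReductionAtPrime q :=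
    hasGoodReductionAtPrime_or_hasMultiplicativeReductionAtPrime_of_not_sq_dvd_conductorNorm (V := V₀) hqsq
  -- a globally minimal model of the twist, and a square root of `q*`
  obtain ⟨Vχ, hEχ, hMχ, v, hv⟩ := exists_minimal_twist_pStar q V₀
  haveI := hEχ
  haveI := hMχ
  haveI : NeZero (Vχ.conductorNorm ℤ) := ⟨(Vχ.conductorNorm_pos_holds).ne'⟩
  have hv' : v • V₀.quadraticTwist (((-1 : ℤ) ^ (q / 2) * q : ℤ) : ℚ) = Vχ := by
    rw [(pStar_intCast q).1]; exact hv
  obtain ⟨s, hs2⟩ := IsAlgClosed.exists_pow_nat_eq ((((-1 : ℤ) ^ (q / 2) * q : ℤ)) : ℂ) two_pos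
  -- ADDV-UNIT-TWIST and TORS-TWIST are theorems at `p ∈ {5, 7}`
  have haddχ : Addv Vχ p := AddvUnitTwist.addv_of_model_twist_auxPrime (by omega) hq hqp hadd₀ ⟨v, hv'⟩
  have hPTχ := TorsTwist.torsTwist57_input p q V₀ hp57 hadd₀ hirr₀ hqp hnsq
    ⟨W', hE', hM', P, hisoVW, hP0, hP⟩ Vχ v hv'
  have hL := hLT p q V₀ D₀ hp5 hirr₀ hq2 hqp hqN' Vχ v hv' s hs2
  -- the repair: a conductor-level datum of `V` with `p ∤ c`
  exact TwistDegreeStepFiveSevenUnitTwist.exists_datum_not_dvd_c_of_kato_of_unitTwist hF hnf hp57 V hirr V₀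
    hiso D₀ hopt₀ hq2 hgm Vχ v hv' haddχ hPTχ s hs2 hL

/-- **KP57 `KPResidueManinUnitFiveSeven` (stmt-BirchSwinnertonDyer-23810) GRANTED modularity, F″ and L-TWIST**:
the route decl BY NAME from `exists_isNewformOf` (modularity, cite-only; the item's own binders construct no
datum), F″ = `kato_neron_isIntegral_twistedSymbolSum_of_additive_five_le` (cite-only) and the twisted-period
decomposition L-TWIST (`hLT`, verbatim the binder of p585596/p589348). Of the item's hypotheses only
`p ∈ {5, 7}`, additivity, `E[p]`-irreducibility and the `ℚ_p`-rational `p`-torsion witness are used. After this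
theorem every Manin binder of the route's `closes` (K★ 22226, TDS57 22227, TDS11 22228, KP57 23810) is reduced
by name to F″ ∧ L-TWIST. CONDITIONAL RESULT; the item stays open for its own signature; BSD is not proved by
this. [cite: Kato2004Asterisque, (8.1.3) (p. 180), Thm. 9.7 (p. 189)] [cite: KostersPannekoek2017, Thm. 1 and Cor. 2]
[cite: Stevens1989, Lemma (5.2) p. 96] -/
theorem kpResidueManinUnitFiveSeven_of_kato_of_periodTwist
    (hnf : exists_isNewformOf)
    (hF : kato_neron_isIntegral_twistedSymbolSum_of_additive_five_le)
    (hLT : ∀ (p : ℕ) [Fact p.Prime] (q : ℕ) [Fact q.Prime] (V₀ : WeierstrassCurve ℚ) [V₀.IsElliptic]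
      [V₀.IsGloballyMinimal] [NeZero (V₀.conductorNorm ℤ)]
      (D₀ : ModularParametrizationData V₀ (V₀.conductorNorm ℤ)), 5 ≤ p → Irr V₀ p → q ≠ 2 → q ≠ p →
      ¬ q ∣ V₀.conductorNorm ℤ →
      ∀ (Vχ : WeierstrassCurve ℚ) [Vχ.IsElliptic] [Vχ.IsGloballyMinimal] (v : VariableChange ℚ),
      v • V₀.quadraticTwist (((-1 : ℤ) ^ (q / 2) * q : ℤ) : ℚ) = Vχ →
      ∀ (s : ℂ), s ^ 2 = (((-1 : ℤ) ^ (q / 2) * q : ℤ) : ℂ) →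
      ∀ (N' : ℕ) [NeZero N'] (g : CuspForm (Gamma0 N') 2), IsNewformOf Vχ g →
      ∀ z ∈ periodLattice D₀.f, ∃ w ∈ periodLattice g, ∃ y ∈ periodLattice D₀.f, z = s * w + (p : ℂ) * y) :
    KPResidueManinUnitFiveSeven := by
  intro p _ V _ _ _ hp57 hadd hirr _ _ hW' _ _
  exact exists_datum_not_dvd_c_of_kato_of_periodTwist_of_torsion hnf hF hLT V hp57 hadd hirr hW'

end Summit.BirchSwinnertonDyer.BirchSwinnertonDyer.Theorems.KPResidueOfKatoPeriodTwist

end
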